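import Summits.CriticalPhenomena.PercolationContinuityZ3.Theorems.PercNearOneGluingNoHeavyLowerTailMajorityGluingQCertSym3Types
import HarnessLib

/-!
# The counting lemma of the type-space checker: cylinder-pair sums as table evaluations (lane prim-rate, constants-miner 1, gen 37 → 38; census/g37/TYPE-SPACE-CHECKER.md step 2)

Support file for the closed crux `NoHeavyLowerTail` (stmt-CriticalPhenomena-4575), majority-gluing line.  For two cylinders of patterns on the first `n` relays
(`cylR n A X` = patterns `K < 2^n` avoiding `A` and containing `X` on those relays) and a lift `t`, and ANY function `g` of the base-`Bs` code of the Venn count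
vector of `(K₁, K₂, t)` over the first `n` relays (`cvcode`), the double sum `Σ_{K₁ ∈ cylR n A X} Σ_{K₂ ∈ cylR n B Y} g(cvcode n K₁ K₂ t)` equals the evaluation
`evalC g` of a TABLE built relay by relay (`tabU`: each relay multiplies in the cells allowed by its states in the two cylinders) — **`cylSum_eq_evalC_tabU`**.
Merging equal codes after each relay (`aggr ∘ msort2`, as the kernel checker will do) preserves the evaluation (`evalC_aggr`, `msort2_perm`).  No sorries.
-/

namespace Summit.CriticalPhenomena.PercolationContinuityZ3.Theorems

namespace HubOnly
namespace QCert

/-! ### Restricted cylinders and count codes -/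

/-- «`K` avoids `A` and contains `X` on the relays `< n`». -/
def cylB (n A X K : ℕ) : Bool := (List.range n).all fun x => (!(tb A x) || !(tb K x)) && (!(tb X x) || tb K x)

/-- The patterns on the first `n` relays in the cylinder `(A, X)`. -/
def cylR (n A X : ℕ) : List ℕ := (List.range (2 ^ n)).filter fun K => cylB n A X K

/-- The base-`Bs` code of the Venn count vector of `(K₁, K₂, t)` over the relays `< n`: `Σ_{x<n} Bs^{cell K₁ K₂ t x}`. -/
def cvcode (Bs n K₁ K₂ t : ℕ) : ℕ := ((List.range n).map fun x => Bs ^ cell K₁ K₂ t x).sum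

/-- The bit values relay `x` may take in the cylinder `(A, X)`: `0` unless `x ∈ X`, `1` unless `x ∈ A`. -/
def allowedBits (A X x : ℕ) : List ℕ := (if tb X x then [] else [0]) ++ (if tb A x then [] else [1])

/-- The Venn cells relay `x` may contribute for the cylinder pair and the lift `t`. -/
def cellsAt (A X B Y t x : ℕ) : List ℕ :=
  (allowedBits A X x).flatMap fun b₁ => (allowedBits B Y x).map fun b₂ => (4 * b₁ + 2 * b₂) + cond (tb t x) 1 0

/-- **The (unmerged) table** of count codes with multiplicities, built relay by relay. -/
def tabU (Bs A X B Y t : ℕ) : ℕ → List (ℕ × ℤ)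
  | 0 => [(0, 1)]
  | n + 1 => (tabU Bs A X B Y t n).flatMap fun e => (cellsAt A X B Y t n).map fun v => (e.1 + Bs ^ v, e.2)

/-- The double cylinder sum of `g ∘ cvcode`. -/
noncomputable def cylSum (Bs A X B Y t n : ℕ) (g : ℕ → ℝ) : ℝ :=
  ((cylR n A X).map fun K₁ => ((cylR n B Y).map fun K₂ => g (cvcode Bs n K₁ K₂ t)).sum).sum

/-! ### One more relay -/

/-- `List.all` respects pointwise equality on members. -/
theorem all_congr_mem {l : List ℕ} {p q : ℕ → Bool} (h : ∀ x ∈ l, p x = q x) : l.all p = l.all q := by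
  induction l with
  | nil => rfl
  | cons a l ih =>
    rw [List.all_cons, List.all_cons, h a (by simp), ih fun x hx => h x (List.mem_cons_of_mem a hx)]

/-- Bits below `n` of `2^n + K`. -/
theorem tb_two_pow_add_lt (n K x : ℕ) (hx : x < n) : tb (2 ^ n + K) x = tb K x := by
  rw [tb_eq, tb_eq, Nat.testBit_two_pow_add_gt hx]

/-- Bit `n` of `2^n + K` for `K < 2^n`. -/
theorem tb_two_pow_add_self (n K : ℕ) (hK : K < 2 ^ n) : tb (2 ^ n + K) n = true := by
  rw [tb_eq, Nat.testBit_two_pow_add_eq, Nat.testBit_lt_two_pow hK]; rfl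

/-- Bit `n` of `K < 2^n`. -/
theorem tb_of_lt (n K : ℕ) (hK : K < 2 ^ n) : tb K n = false := by
  rw [tb_eq, Nat.testBit_lt_two_pow hK]

/-- Cylinder membership on `n + 1` relays, low half. -/
theorem cylB_succ_low (n A X K : ℕ) (hK : K < 2 ^ n) : cylB (n + 1) A X K = (cylB n A X K && !(tb X n)) := by
  unfold cylB
  rw [List.range_succ, List.all_append, List.all_cons, List.all_nil, Bool.and_true, tb_of_lt n K hK]
  cases tb A n <;> cases tb X n <;> simp

/-- Cylinder membership on `n + 1` relays, high half. -/
theorem cylB_succ_high (n A X K : ℕ) (hK : K < 2 ^ n) : cylB (n + 1) A X (2 ^ n + K) = (cylB n A X K && !(tb A n)) := by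
  unfold cylB
  rw [List.range_succ, List.all_append, List.all_cons, List.all_nil, Bool.and_true, tb_two_pow_add_self n K hK]
  have h : ((List.range n).all fun x => (!tb A x || !tb (2 ^ n + K) x) && (!tb X x || tb (2 ^ n + K) x)) =
      (List.range n).all fun x => (!tb A x || !tb K x) && (!tb X x || tb K x) :=
    all_congr_mem fun x hx => by rw [tb_two_pow_add_lt n K x (List.mem_range.mp hx)]
  rw [h]
  cases tb A n <;> cases tb X n <;> simp

/-- **The cylinder on `n + 1` relays**: the low half (if `n ∉ X`) followed by the shifted high half (if `n ∉ A`). -/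
theorem cylR_succ (n A X : ℕ) : cylR (n + 1) A X =
    (if tb X n then [] else cylR n A X) ++ (if tb A n then [] else (cylR n A X).map fun K => 2 ^ n + K) := by
  unfold cylR
  rw [pow_succ, mul_two, List.range_add, List.filter_append, List.filter_map]
  congr 1
  · by_cases hX : tb X n = true
    · rw [if_pos hX, List.filter_eq_nil_iff]
      intro K hK; rw [cylB_succ_low n A X K (List.mem_range.mp hK), hX]; simp
    · rw [if_neg hX]
      exact List.filter_congr fun K hK => by rw [cylB_succ_low n A X K (List.mem_range.mp hK)]; simp [hX]
  · by_cases hA : tb A n = true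
    · rw [if_pos hA, List.map_eq_nil_iff, List.filter_eq_nil_iff]
      intro K hK; simp only [Function.comp]; rw [cylB_succ_high n A X K (List.mem_range.mp hK), hA]; simp
    · rw [if_neg hA]
      congr 1
      exact List.filter_congr fun K hK => by simp only [Function.comp]; rw [cylB_succ_high n A X K (List.mem_range.mp hK)]; simp [hA]

/-- Members of `cylR n` are below `2^n`. -/
theorem lt_of_mem_cylR {n A X K : ℕ} (h : K ∈ cylR n A X) : K < 2 ^ n :=
  List.mem_range.mp (List.mem_filter.mp h).1

/-- The count code over `n + 1` relays: the old code plus the new relay's cell. -/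
theorem cvcode_succ (Bs n K₁ K₂ t : ℕ) : cvcode Bs (n + 1) K₁ K₂ t = cvcode Bs n K₁ K₂ t + Bs ^ cell K₁ K₂ t n := by
  unfold cvcode; rw [List.range_succ, List.map_append, List.sum_append, List.map_singleton, List.sum_singleton]

/-- The count code over the relays `< n` ignores bit `n` and above: shifting `K₁` by `2^n`. -/
theorem cvcode_high₁ (Bs n K₁ K₂ t : ℕ) : cvcode Bs n (2 ^ n + K₁) K₂ t = cvcode Bs n K₁ K₂ t := by
  unfold cvcode
  congr 1
  exact List.map_congr_left fun x hx => by unfold cell; rw [tb_two_pow_add_lt n K₁ x (List.mem_range.mp hx)]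

/-- … and shifting `K₂` by `2^n`. -/
theorem cvcode_high₂ (Bs n K₁ K₂ t : ℕ) : cvcode Bs n K₁ (2 ^ n + K₂) t = cvcode Bs n K₁ K₂ t := by
  unfold cvcode
  congr 1
  exact List.map_congr_left fun x hx => by unfold cell; rw [tb_two_pow_add_lt n K₂ x (List.mem_range.mp hx)]

/-- The new relay's cell for given bits. -/
theorem cell_at (K₁ K₂ t n b₁ b₂ : ℕ) (h₁ : tb K₁ n = decide (b₁ = 1)) (h₂ : tb K₂ n = decide (b₂ = 1)) (hb₁ : b₁ ≤ 1) (hb₂ : b₂ ≤ 1) :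
    cell K₁ K₂ t n = (4 * b₁ + 2 * b₂) + cond (tb t n) 1 0 := by
  unfold cell; rw [h₁, h₂]
  interval_cases b₁ <;> interval_cases b₂ <;> simp

/-! ### Evaluation of tables -/

/-- `evalC` of a `flatMap`. -/
theorem evalC_flatMap (g : ℕ → ℝ) (l : List (ℕ × ℤ)) (f : ℕ × ℤ → List (ℕ × ℤ)) :
    evalC g (l.flatMap f) = (l.map fun e => evalC g (f e)).sum := by
  induction l with
  | nil => simp [evalC]
  | cons e l ih => rw [List.flatMap_cons, evalC_append, ih, List.map_cons, List.sum_cons]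

/-- Shifting all codes by `s` = evaluating at the shifted function. -/
theorem evalC_map_shift (g : ℕ → ℝ) (s : ℕ) (l : List (ℕ × ℤ)) :
    evalC g (l.map fun e => (e.1 + s, e.2)) = evalC (fun c => g (c + s)) l := by
  induction l with
  | nil => simp [evalC]
  | cons e l ih => unfold evalC at *; simp only [List.map_cons, List.sum_cons] at *; rw [ih]

/-- One table step: `evalC g (tabU (n+1)) = Σ_{v ∈ cellsAt n} evalC (g (· + Bs^v)) (tabU n)`. -/
theorem evalC_tabU_succ (Bs A X B Y t n : ℕ) (g : ℕ → ℝ) :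
    evalC g (tabU Bs A X B Y t (n + 1)) = ((cellsAt A X B Y t n).map fun v => evalC (fun c => g (c + Bs ^ v)) (tabU Bs A X B Y t n)).sum := by
  rw [tabU, evalC_flatMap]
  -- swap the two finite sums
  induction tabU Bs A X B Y t n with
  | nil => simp [evalC]
  | cons e l ih =>
    rw [List.map_cons, List.sum_cons, ih]
    have h1 : evalC g ((cellsAt A X B Y t n).map fun v => (e.1 + Bs ^ v, e.2)) =
        ((cellsAt A X B Y t n).map fun v => (e.2 : ℝ) * g (e.1 + Bs ^ v)).sum := by
      unfold evalC; rw [List.map_map]; rfl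
    rw [h1]
    have h2 : ∀ v : ℕ, evalC (fun c => g (c + Bs ^ v)) (e :: l) = (e.2 : ℝ) * g (e.1 + Bs ^ v) + evalC (fun c => g (c + Bs ^ v)) l := fun v => by
      unfold evalC; rw [List.map_cons, List.sum_cons]
    simp only [h2]
    rw [List.sum_map_add]


/-! ### The counting lemma -/

/-- The cylinder on `n + 1` relays as a `flatMap` over the new relay's allowed bits. -/
theorem cylR_succ' (n A X : ℕ) : cylR (n + 1) A X = (allowedBits A X n).flatMap fun b => (cylR n A X).map fun K => b * 2 ^ n + K := by
  rw [cylR_succ, allowedBits]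
  cases tb X n <;> cases tb A n <;> simp [List.flatMap_cons]

/-- Sum over a `flatMap`. -/
theorem sum_map_flatMap (l : List ℕ) (f : ℕ → List ℕ) (h : ℕ → ℝ) :
    ((l.flatMap f).map h).sum = (l.map fun b => ((f b).map h).sum).sum := by
  induction l with
  | nil => simp
  | cons a l ih => rw [List.flatMap_cons, List.map_append, List.sum_append, ih, List.map_cons, List.sum_cons]

/-- Swapping two finite sums. -/
theorem sum_map_swap (l₁ l₂ : List ℕ) (F : ℕ → ℕ → ℝ) :
    (l₁.map fun a => (l₂.map fun b => F a b).sum).sum = (l₂.map fun b => (l₁.map fun a => F a b).sum).sum := by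
  induction l₁ with
  | nil => simp
  | cons a l ih => rw [List.map_cons, List.sum_cons, ih, ← List.sum_map_add]; rfl

/-- Allowed bits are bits. -/
theorem le_one_of_mem_allowedBits {A X x b : ℕ} (h : b ∈ allowedBits A X x) : b ≤ 1 := by
  unfold allowedBits at h
  cases hX : tb X x <;> cases hA : tb A x <;> simp [hX, hA] at h <;> omega

/-- Bit `n` of `b·2^n + K` (`K < 2^n`, `b ≤ 1`). -/
theorem tb_bit_shift (n K b : ℕ) (hK : K < 2 ^ n) (hb : b ≤ 1) : tb (b * 2 ^ n + K) n = decide (b = 1) := by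
  interval_cases b
  · rw [zero_mul, zero_add, tb_of_lt n K hK]; rfl
  · rw [one_mul, tb_two_pow_add_self n K hK]; rfl

/-- The count code of shifted patterns over the relays `< n`. -/
theorem cvcode_shift (Bs n K₁ K₂ t b₁ b₂ : ℕ) (hb₁ : b₁ ≤ 1) (hb₂ : b₂ ≤ 1) :
    cvcode Bs n (b₁ * 2 ^ n + K₁) (b₂ * 2 ^ n + K₂) t = cvcode Bs n K₁ K₂ t := by
  interval_cases b₁ <;> interval_cases b₂ <;> simp [cvcode_high₁, cvcode_high₂]

/-- **THE COUNTING LEMMA.**  The double cylinder sum of any function of the count code is the evaluation of the relay-by-relay table. -/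
theorem cylSum_eq_evalC_tabU (Bs A X B Y t : ℕ) : ∀ (n : ℕ) (g : ℕ → ℝ), cylSum Bs A X B Y t n g = evalC g (tabU Bs A X B Y t n)
  | 0, g => by simp [cylSum, cylR, cylB, cvcode, tabU, evalC]
  | n + 1, g => by
    have IH := cylSum_eq_evalC_tabU Bs A X B Y t n
    rw [evalC_tabU_succ]
    unfold cylSum
    rw [cylR_succ' n A X, cylR_succ' n B Y, sum_map_flatMap]
    unfold cellsAt
    rw [sum_map_flatMap]
    refine congrArg List.sum (List.map_congr_left fun b₁ hb₁ => ?_)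
    have hb₁' := le_one_of_mem_allowedBits hb₁
    rw [List.map_map, List.map_map]
    -- inner: Σ_{K₁'} Σ_{K₂ ∈ cylR (n+1) B Y} …  →  Σ_{b₂} Σ_{K₁'} Σ_{K₂'} …
    have step : ∀ K₁ ∈ cylR n A X, (((allowedBits B Y n).flatMap fun b => (cylR n B Y).map fun K => b * 2 ^ n + K).map
        fun K₂ => g (cvcode Bs (n + 1) (b₁ * 2 ^ n + K₁) K₂ t)).sum =
        ((allowedBits B Y n).map fun b₂ => ((cylR n B Y).map fun K₂ => g (cvcode Bs n K₁ K₂ t + Bs ^ ((4 * b₁ + 2 * b₂) + cond (tb t n) 1 0))).sum).sum := by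
      intro K₁ hK₁
      rw [sum_map_flatMap]
      refine congrArg List.sum (List.map_congr_left fun b₂ hb₂ => ?_)
      have hb₂' := le_one_of_mem_allowedBits hb₂
      rw [List.map_map]
      refine congrArg List.sum (List.map_congr_left fun K₂ hK₂ => ?_)
      simp only [Function.comp]
      rw [cvcode_succ, cvcode_shift Bs n K₁ K₂ t b₁ b₂ hb₁' hb₂',
        cell_at _ _ t n b₁ b₂ (tb_bit_shift n K₁ b₁ (lt_of_mem_cylR hK₁) hb₁') (tb_bit_shift n K₂ b₂ (lt_of_mem_cylR hK₂) hb₂') hb₁' hb₂']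
    have hL : ((cylR n A X).map ((fun K₁ => (((allowedBits B Y n).flatMap fun b => (cylR n B Y).map fun K => b * 2 ^ n + K).map
        fun K₂ => g (cvcode Bs (n + 1) K₁ K₂ t)).sum) ∘ fun K => b₁ * 2 ^ n + K)).sum =
        ((cylR n A X).map fun K₁ => ((allowedBits B Y n).map fun b₂ =>
          ((cylR n B Y).map fun K₂ => g (cvcode Bs n K₁ K₂ t + Bs ^ ((4 * b₁ + 2 * b₂) + cond (tb t n) 1 0))).sum).sum).sum :=
      congrArg List.sum (List.map_congr_left fun K₁ hK₁ => by simp only [Function.comp]; exact step K₁ hK₁)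
    rw [hL, sum_map_swap]
    refine congrArg List.sum (List.map_congr_left fun b₂ _ => ?_)
    simp only [Function.comp]
    exact IH (fun c => g (c + Bs ^ ((4 * b₁ + 2 * b₂) + cond (tb t n) 1 0)))

end QCert
end HubOnly

end Summit.CriticalPhenomena.PercolationContinuityZ3.Theorems
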